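import Summits.ValiantsHypothesis.ValiantsHypothesis.Theorems.KPlusLogSqLawWindowDescartesOneSided

/-!
# `DoorA26` census — LAGUERRE'S PARTIAL-SUM RULES (zeros below / above a test abscissa), the exponent-free junction rows

HONEST FRAMING.  Object-search cell `pub-symmetroid`, seat `val-sym-door-p1` (gen 12); helper file `--supports`
stmt-ValiantsHypothesis-19979 (`DoorA26 := PosRootLawAt 2 6 19`, OPEN, typed, never asserted).  Nothing here bounds
`ζ_sym(2,6)`; registers unchanged; nothing bears on `MatrixDescartes` (stmt-ValiantsHypothesis-18050) or on `VP ≠ VNP`.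

CONTENT (theorems about real polynomials, then their reading for the census line).  LAGUERRE'S RULES (1883): for a real
polynomial `f = ∑ c_k X^k` and a test abscissa `a > 0`,
* `laguerre_sgnChanges_below`: along every strictly increasing list of points of `(0, a)` the values of `f` change sign at most
  `V(S_0(a), …, S_N(a))` times, where `S_m(a) = ∑_{k ≤ m} c_k a^k` are the BOTTOM PARTIAL SUMS of `f` at `a`;
* `laguerre_sgnChanges_above`: along every strictly increasing list of points of `(a, ∞)` the values change sign at most
  `V(T_0(a), …, T_N(a))` times, `T_m(a) = ∑_{m ≤ k ≤ N} c_k a^k` the TOP PARTIAL SUMS.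
Both refine Descartes' rule (`a → ∞` resp. `a → 0⁺` give back `V(c_0, …, c_N)`), and — unlike the dominance («window») forms
of `…KPlusLogSqLawWindowDescartesOneSided` — they need NO hypothesis on `f` at `a`.
PROOF (finite): for `M ≥ N` the polynomial `Q_M(x) = ∑_{m ≤ M} S_{min(m,N)}(a) (x/a)^m` satisfies the telescoping identity
`(1 − x/a)·Q_M(x) = f(x) − S_N(a)·(x/a)^(M+1)` (`laguerre_identity`), so for `M` large `Q_M` has the sign of `f` at the finitely
many sample points; Descartes along points (`WindowDescartes.sgnChanges_eval_le_signVariations`, Mathlib's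
`Polynomial.roots_countP_pos_le_signVariations` inside) bounds the sign changes by `signVariations Q_M`, whose coefficient list is
`S_0, …, S_N` followed by copies of `S_N` (`WindowDescartes.sgnChanges_slist_add_of_sameSign_top`).  The rule above `a` is the
rule below `1` for the reflected polynomial `g(u) = ∑_j c_{N−j} a^{N−j} u^j` (`u = a/x`, `g(a/x) = (a/x)^N f(x)`).

READING FOR THE LINE `census` / R∞.1 (why this is filed under the door).  (i) TEST-ABSCISSA ROWS: a hypothetical twenty has,
at every `t > 0` with `det F(t) ≠ 0`, `#roots below t ≤ V(bottom partial sums at t)` and `#roots above t ≤ V(top partial sums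
at t)` — LINEAR sign conditions on the 21 coefficients at fixed `t` (no Rolle descent, no Newton-cone constants); located
(exp/laguerre_rows.py of the seat): at `t = 161/32` the kernel pseudo-twenty of `…CensusPseudoTwenty000203081933` (which passes
every sign + C25 + Gram row) has `V(bottom) = 18`, `V(top) = 0`, i.e. at most 18 roots — the row family bites where (N)+(G)
cannot.  (ii) JUNCTION ROWS ARE EXPONENT-FREE: for a SEPARATED configuration (all det-roots below `t`, all roots of a Gram
row / diagonal entry above `t`), scaling `t = 1` turns both rules into conditions on partial sums of the Gram coefficients in
CHAMBER ORDER — the exponents disappear (seat memo DOOR-A26-P1G12-LAGUERRE.md).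
[cite: Laguerre1883, the partial-sum rules; see also Pólya–Szegő, Problems and Theorems in Analysis II, Part V, Ch. 1, §3];
axioms standard; no definitions.
-/

set_option linter.dupNamespace false
set_option autoImplicit false

namespace Summit.ValiantsHypothesis.ValiantsHypothesis.Theorems.LacunarySymmetroidMatrixDescartes.Census

open Polynomial
open Summit.ValiantsHypothesis.ValiantsHypothesis.Theorems.KPlusLogSqLaw.WindowDescartes

section Laguerre

/-! ### The telescoping identity -/

/-- **Telescoping identity behind Laguerre's rule.**  With `S m = ∑_{k ≤ m} c k · a^k`:
`(1 − t) · ∑_{m ≤ n} S m · t^m + S n · t^(n+1) = ∑_{k ≤ n} c k · a^k · t^k`. [folklore] -/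
theorem laguerre_telescope (c : ℕ → ℝ) (a t : ℝ) (n : ℕ) :
    (1 - t) * (∑ m ∈ Finset.range (n + 1), (∑ k ∈ Finset.range (m + 1), c k * a ^ k) * t ^ m)
        + (∑ k ∈ Finset.range (n + 1), c k * a ^ k) * t ^ (n + 1)
      = ∑ k ∈ Finset.range (n + 1), c k * a ^ k * t ^ k := by
  induction n with
  | zero => simp; ring
  | succ n ih =>
    rw [Finset.sum_range_succ (fun m => (∑ k ∈ Finset.range (m + 1), c k * a ^ k) * t ^ m),
      Finset.sum_range_succ (fun k => c k * a ^ k * t ^ k), ← ih,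
      Finset.sum_range_succ (fun k => c k * a ^ k) (n + 1)]
    ring

/-- a finite geometric telescoping: `(1 − t) · ∑_{n < m ≤ M} t^m = t^(n+1) − t^(M+1)`. [folklore] -/
theorem one_sub_mul_sum_Ico_pow (t : ℝ) {n M : ℕ} (h : n ≤ M) :
    (1 - t) * ∑ m ∈ Finset.Ico (n + 1) (M + 1), t ^ m = t ^ (n + 1) - t ^ (M + 1) := by
  induction M with
  | zero =>
    have : n = 0 := Nat.le_zero.mp h
    subst this; simp
  | succ M ih =>
    rcases Nat.lt_or_ge n (M + 1) with hlt | hge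
    · rw [Finset.sum_Ico_succ_top (by omega : n + 1 ≤ M + 1), mul_add, ih (by omega)]
      ring
    · have : n = M + 1 := le_antisymm h hge
      subst this; simp

/-- **Laguerre's identity.**  For `M ≥ N ≥ natDegree f`, `a ≠ 0`, with `S m = ∑_{k ≤ m} coeff f k · a^k` and the truncated
smoothing `Q_M(x) = ∑_{m ≤ M} S (min m N) · (x/a)^m`:  `(1 − x/a) · Q_M(x) = f(x) − S N · (x/a)^(M+1)`. [folklore] -/
theorem laguerre_identity (f : ℝ[X]) {N : ℕ} (hN : f.natDegree ≤ N) {a : ℝ} (ha : a ≠ 0) {M : ℕ} (hM : N ≤ M) (x : ℝ) :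
    (1 - x / a) * (∑ m ∈ Finset.range (M + 1), (∑ k ∈ Finset.range (min m N + 1), f.coeff k * a ^ k) * (x / a) ^ m)
      = f.eval x - (∑ k ∈ Finset.range (N + 1), f.coeff k * a ^ k) * (x / a) ^ (M + 1) := by
  set t := x / a with ht
  set S : ℕ → ℝ := fun m => ∑ k ∈ Finset.range (m + 1), f.coeff k * a ^ k with hS
  -- split the sum at `N`
  have hsplit : ∑ m ∈ Finset.range (M + 1), S (min m N) * t ^ m
      = (∑ m ∈ Finset.range (N + 1), S m * t ^ m) + S N * ∑ m ∈ Finset.Ico (N + 1) (M + 1), t ^ m := by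
    rw [Finset.range_eq_Ico, ← Finset.sum_Ico_consecutive _ (Nat.zero_le (N + 1)) (by omega : N + 1 ≤ M + 1),
      ← Finset.range_eq_Ico, Finset.mul_sum]
    congr 1
    · exact Finset.sum_congr rfl fun m hm => by
        rw [Finset.mem_range] at hm; rw [Nat.min_eq_left (by omega)]
    · exact Finset.sum_congr rfl fun m hm => by
        rw [Finset.mem_Ico] at hm; rw [Nat.min_eq_right (by omega)]
  have hf : f.eval x = ∑ k ∈ Finset.range (N + 1), f.coeff k * a ^ k * t ^ k := by
    rw [Polynomial.eval_eq_sum_range' (Nat.lt_succ_of_le hN) x]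
    refine Finset.sum_congr rfl fun k _ => ?_
    rw [ht, div_pow, mul_assoc, mul_div_cancel₀ _ (pow_ne_zero k ha)]
  change (1 - t) * (∑ m ∈ Finset.range (M + 1), S (min m N) * t ^ m) = f.eval x - S N * t ^ (M + 1)
  rw [hsplit, mul_add, hf, ← laguerre_telescope (fun k => f.coeff k) a t N]
  have hgeo := one_sub_mul_sum_Ico_pow t hM
  simp only [hS]
  rw [show (1 - t) * (S N * ∑ m ∈ Finset.Ico (N + 1) (M + 1), t ^ m) = S N * ((1 - t) * ∑ m ∈ Finset.Ico (N + 1) (M + 1), t ^ m)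
    by ring, hgeo]
  simp only [hS]
  ring

/-! ### Laguerre's rule below a test abscissa -/

/-- **LAGUERRE'S RULE, zeros below `a`** (sign-change form).  `f` real, `natDegree f ≤ N`, `0 < a`; along any strictly
increasing list of points of `(0, a)` the values of `f` change sign at most `V(S_0, …, S_N)` times, where
`S_m = ∑_{k ≤ m} coeff f k · a^k` are the bottom partial sums of `f` at `a` (zeros ignored on both sides).
[cite: Laguerre1883, the partial-sum rules; Pólya–Szegő II Part V Ch. 1 §3] -/
theorem laguerre_sgnChanges_below (f : ℝ[X]) {N : ℕ} (hN : f.natDegree ≤ N) {a : ℝ} (ha : 0 < a)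
    (xs : List ℝ) (hsort : xs.Pairwise (· < ·)) (hx0 : ∀ x ∈ xs, 0 < x) (hxa : ∀ x ∈ xs, x < a) :
    sgnChanges (xs.map fun x => f.eval x)
      ≤ sgnChanges (slist (fun m => ∑ k ∈ Finset.range (m + 1), f.coeff k * a ^ k) N) := by
  have ha0 : a ≠ 0 := ha.ne'
  set S : ℕ → ℝ := fun m => ∑ k ∈ Finset.range (m + 1), f.coeff k * a ^ k with hS
  -- Step 1: discard the sample points where `f` vanishes
  set xs' := xs.filter (fun x => f.eval x ≠ 0) with hxs'
  have hred : sgnChanges (xs.map fun x => f.eval x) = sgnChanges (xs'.map fun x => f.eval x) := by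
    rw [← sgnChanges_filter_ne_zero, List.filter_map]; rfl
  have hsort' : xs'.Pairwise (· < ·) := hsort.filter _
  have hx0' : ∀ x ∈ xs', 0 < x := fun x hx => hx0 x (List.mem_of_mem_filter hx)
  have hxa' : ∀ x ∈ xs', x < a := fun x hx => hxa x (List.mem_of_mem_filter hx)
  have hne' : ∀ x ∈ xs', f.eval x ≠ 0 := fun x hx => by simpa using (List.mem_filter.mp hx).2
  rw [hred]
  -- Step 2: the truncated smoothing `Q M`
  let γ : ℕ → ℕ → ℝ := fun M m => S (min m N) * (a⁻¹) ^ m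
  let Q : ℕ → ℝ[X] := fun M => ∑ m ∈ Finset.range (M + 1), Polynomial.monomial m (γ M m)
  have hQcoeff : ∀ M m, (Q M).coeff m = if m < M + 1 then γ M m else 0 := by
    intro M m
    simp only [Q, Polynomial.finsetSum_coeff, Polynomial.coeff_monomial, Finset.sum_ite_eq', Finset.mem_range]
  have hQdeg : ∀ M, (Q M).natDegree ≤ M := by
    intro M
    rw [Polynomial.natDegree_le_iff_coeff_eq_zero]
    intro i hi
    rw [hQcoeff, if_neg (by exact_mod_cast (show ¬ (i < M + 1) by exact_mod_cast (by omega)))]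
  have hQeval : ∀ M x, (Q M).eval x = ∑ m ∈ Finset.range (M + 1), S (min m N) * (x / a) ^ m := by
    intro M x
    simp only [Q, Polynomial.eval_finsetSum, Polynomial.eval_monomial, γ]
    refine Finset.sum_congr rfl fun m _ => ?_
    rw [div_eq_mul_inv, mul_pow, mul_assoc, mul_comm (x ^ m)]
  -- Step 3: choose `M ≥ N` with the error term smaller than `|f x|` at every sample point
  have hM : ∃ M₀ : ℕ, ∀ M, M₀ ≤ M → ∀ x ∈ xs', |S N * (x / a) ^ (M + 1)| < |f.eval x| := by
    refine exists_forall_ge_of_forall_mem xs' fun x hx => ?_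
    have hq0 : 0 ≤ x / a := div_nonneg (hx0' x hx).le ha.le
    have hq1 : x / a < 1 := (div_lt_one ha).mpr (hxa' x hx)
    have hfx : 0 < |f.eval x| := abs_pos.mpr (hne' x hx)
    rcases eq_or_ne (S N) 0 with h0 | h0
    · exact ⟨0, fun M _ => by rw [h0, zero_mul, abs_zero]; exact hfx⟩
    · have hS0 : 0 < |S N| := abs_pos.mpr h0
      obtain ⟨n, hn⟩ := exists_pow_lt_of_lt_one (div_pos hfx hS0) hq1
      refine ⟨n, fun M hM => ?_⟩
      rw [abs_mul, abs_pow, abs_of_nonneg hq0]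
      calc |S N| * (x / a) ^ (M + 1) ≤ |S N| * (x / a) ^ n :=
            mul_le_mul_of_nonneg_left (pow_le_pow_of_le_one hq0 hq1.le (by omega)) hS0.le
        _ < |S N| * (|f.eval x| / |S N|) := mul_lt_mul_of_pos_left hn hS0
        _ = |f.eval x| := mul_div_cancel₀ _ hS0.ne'
  obtain ⟨M₀, hM₀⟩ := hM
  set M := max M₀ N with hMdef
  have hMN : N ≤ M := le_max_right _ _
  have herr := hM₀ M (le_max_left _ _)
  -- Step 4: at the sample points `Q M` has the sign of `f`
  have hsign : ∀ x ∈ xs', SignType.sign (f.eval x) = SignType.sign ((Q M).eval x) := by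
    intro x hx
    have h1x : 0 < 1 - x / a := by have := (div_lt_one ha).mpr (hxa' x hx); linarith
    have hid := laguerre_identity f hN ha0 hMN x
    rw [← hQeval] at hid
    -- `(1 - x/a) Q = f - err`, `|err| < |f|`
    have hQ : SignType.sign ((Q M).eval x) = SignType.sign (f.eval x + (-(S N * (x / a) ^ (M + 1)))) := by
      rw [← sub_eq_add_neg, ← hid, sign_mul, sign_pos h1x, one_mul]
    rw [hQ, sign_add_eq_sign_of_abs_lt (by rw [abs_neg]; exact herr x hx)]
  have hQne : ∀ x ∈ xs', (Q M).eval x ≠ 0 := by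
    intro x hx h0
    have := hsign x hx
    rw [h0, sign_zero, sign_eq_zero_iff] at this
    exact hne' x hx this
  -- Step 5: Descartes along the points for `Q M`, and its coefficient sign pattern
  calc sgnChanges (xs'.map fun x => f.eval x)
      = sgnChanges (xs'.map fun x => (Q M).eval x) := sgnChanges_congr (forall₂_map_of_forall hsign)
    _ ≤ (Q M).signVariations := sgnChanges_eval_le_signVariations (Q M) xs' hsort' hx0' hQne
    _ = sgnChanges (slist (fun m => (Q M).coeff m) M) := signVariations_eq_sgnChanges_slist (Q M) (hQdeg M)
    _ = sgnChanges (slist (fun m => S (min m N)) M) := by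
        refine sgnChanges_slist_congr_sign fun m hm => ?_
        rw [hQcoeff, if_pos (by omega)]
        show SignType.sign (S (min m N) * (a⁻¹) ^ m) = SignType.sign (S (min m N))
        rw [sign_mul, sign_pos (pow_pos (inv_pos.mpr ha) m), mul_one]
    _ = sgnChanges (slist (fun m => S (min m N)) N) := by
        obtain ⟨e, he⟩ : ∃ e, M = N + e := ⟨M - N, by omega⟩
        rw [he]
        rcases eq_or_ne (S N) 0 with h0 | h0
        · refine sgnChanges_slist_eq_of_zero_above _ N e fun i hi _ => ?_
          show S (min i N) = 0
          rw [Nat.min_eq_right hi.le, h0]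
        · have hNN : (fun m => S (min m N)) N ≠ 0 := by simpa using h0
          refine sgnChanges_slist_add_of_sameSign_top _ N e hNN fun i hi _ => ?_
          show 0 < S (min i N) * S (min N N)
          rw [Nat.min_eq_right hi.le, Nat.min_self]
          exact mul_self_pos.mpr h0
    _ = sgnChanges (slist S N) := congrArg sgnChanges (slist_congr fun m hm => by
        show S (min m N) = S m; rw [Nat.min_eq_left hm])

/-! ### Laguerre's rule above a test abscissa -/

/-- reindexing: `∑_{j ≤ m} c (N − j) = ∑_{N − m ≤ k ≤ N} c k` for `m ≤ N`. [folklore] -/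
theorem sum_range_reflect_eq_sum_Ico (c : ℕ → ℝ) {N m : ℕ} (hm : m ≤ N) :
    ∑ j ∈ Finset.range (m + 1), c (N - j) = ∑ k ∈ Finset.Ico (N - m) (N + 1), c k := by
  rw [Finset.sum_Ico_eq_sum_range, show N + 1 - (N - m) = m + 1 by omega,
    ← Finset.sum_range_reflect (fun j => c (N - j)) (m + 1)]
  refine Finset.sum_congr rfl fun i hi => ?_
  rw [Finset.mem_range] at hi
  congr 1; omega

/-- **LAGUERRE'S RULE, zeros above `a`** (sign-change form).  `f` real, `natDegree f ≤ N`, `0 < a`; along any strictly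
increasing list of points of `(a, ∞)` the values of `f` change sign at most `V(T_N, …, T_0)` times, where
`T_m = ∑_{m ≤ k ≤ N} coeff f k · a^k` are the top partial sums of `f` at `a` (zeros ignored on both sides).
[cite: Laguerre1883, the partial-sum rules; Pólya–Szegő II Part V Ch. 1 §3] -/
theorem laguerre_sgnChanges_above (f : ℝ[X]) {N : ℕ} (hN : f.natDegree ≤ N) {a : ℝ} (ha : 0 < a)
    (xs : List ℝ) (hsort : xs.Pairwise (· < ·)) (hxa : ∀ x ∈ xs, a < x) :
    sgnChanges (xs.map fun x => f.eval x)
      ≤ sgnChanges (slist (fun m => ∑ k ∈ Finset.Ico m (N + 1), f.coeff k * a ^ k) N) := by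
  have ha0 : a ≠ 0 := ha.ne'
  have hx0 : ∀ x ∈ xs, 0 < x := fun x hx => ha.trans (hxa x hx)
  -- the reflected polynomial `g(u) = ∑_j coeff f (N - j) · a^(N-j) · u^j`
  let δ : ℕ → ℝ := fun j => f.coeff (N - j) * a ^ (N - j)
  let g : ℝ[X] := ∑ j ∈ Finset.range (N + 1), Polynomial.monomial j (δ j)
  have hgcoeff : ∀ j, g.coeff j = if j < N + 1 then δ j else 0 := by
    intro j
    simp only [g, Polynomial.finsetSum_coeff, Polynomial.coeff_monomial, Finset.sum_ite_eq', Finset.mem_range]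
  have hgdeg : g.natDegree ≤ N := by
    rw [Polynomial.natDegree_le_iff_coeff_eq_zero]
    intro i hi
    rw [hgcoeff, if_neg (by exact_mod_cast (show ¬ (i < N + 1) by exact_mod_cast (by omega)))]
  have hgeval : ∀ x, x ≠ 0 → g.eval (a / x) = (a / x) ^ N * f.eval x := by
    intro x hx
    simp only [g, Polynomial.eval_finsetSum, Polynomial.eval_monomial, δ]
    rw [Polynomial.eval_eq_sum_range' (Nat.lt_succ_of_le hN) x, Finset.mul_sum,
      ← Finset.sum_range_reflect (fun k => (a / x) ^ N * (f.coeff k * x ^ k)) (N + 1)]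
    refine Finset.sum_congr rfl fun j hj => ?_
    rw [Finset.mem_range] at hj
    rw [show N + 1 - 1 - j = N - j by omega]
    have hsplit : (a / x) ^ N = (a / x) ^ (N - j) * (a / x) ^ j := by rw [← pow_add]; congr 1; omega
    rw [hsplit, div_pow a x (N - j)]
    field_simp
  -- the reflected sample points `a / x`, in increasing order
  set us := (xs.map fun x => a / x).reverse with hus
  have husort : us.Pairwise (· < ·) := by
    rw [hus, List.pairwise_reverse, List.pairwise_map]
    exact hsort.imp_of_mem fun {x y} hx hy hxy => div_lt_div_of_pos_left ha (hx0 x hx) hxy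
  have hu0 : ∀ u ∈ us, 0 < u := by
    intro u hu
    rw [hus, List.mem_reverse, List.mem_map] at hu
    obtain ⟨x, hx, rfl⟩ := hu
    exact div_pos ha (hx0 x hx)
  have hu1 : ∀ u ∈ us, u < 1 := by
    intro u hu
    rw [hus, List.mem_reverse, List.mem_map] at hu
    obtain ⟨x, hx, rfl⟩ := hu
    exact (div_lt_one (hx0 x hx)).mpr (hxa x hx)
  -- values of `g` along `us` have the signs of the values of `f` along `xs`, reversed
  have hvals : sgnChanges (xs.map fun x => f.eval x) = sgnChanges (us.map fun u => g.eval u) := by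
    rw [hus, List.map_reverse, sgnChanges_reverse, List.map_map]
    refine sgnChanges_congr (forall₂_map_of_forall fun x hx => ?_)
    show SignType.sign (f.eval x) = SignType.sign (g.eval (a / x))
    rw [hgeval x (hx0 x hx).ne', sign_mul, sign_pos (pow_pos (div_pos ha (hx0 x hx)) N), one_mul]
  rw [hvals]
  -- Laguerre below `1` for `g`
  have hbelow := laguerre_sgnChanges_below g hgdeg one_pos us husort hu0 hu1
  refine hbelow.trans (le_of_eq ?_)
  -- the bottom partial sums of `g` at `1` are the top partial sums of `f` at `a`, in reversed order
  have hpart : ∀ m, m ≤ N → ∑ k ∈ Finset.range (m + 1), g.coeff k * (1 : ℝ) ^ k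
      = ∑ k ∈ Finset.Ico (N - m) (N + 1), f.coeff k * a ^ k := by
    intro m hm
    rw [← sum_range_reflect_eq_sum_Ico (fun k => f.coeff k * a ^ k) hm]
    refine Finset.sum_congr rfl fun j hj => ?_
    rw [Finset.mem_range] at hj
    rw [one_pow, mul_one, hgcoeff, if_pos (by omega)]
  rw [slist_congr (fun m hm => hpart m hm)]
  have hrefl := slist_reflect (fun m => ∑ k ∈ Finset.Ico m (N + 1), f.coeff k * a ^ k) N
  rw [show (fun j => ∑ k ∈ Finset.Ico (N - j) (N + 1), f.coeff k * a ^ k)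
      = (fun j => (fun m => ∑ k ∈ Finset.Ico m (N + 1), f.coeff k * a ^ k) (N - j)) from rfl, hrefl, sgnChanges_reverse]

/-! ### The two rules at one test abscissa -/

/-- **LAGUERRE ROWS AT A TEST ABSCISSA.**  For a real polynomial `f` (`natDegree f ≤ N`) and `t > 0`: along any strictly
increasing list of POSITIVE points avoiding `t`, the sign changes of the values of `f` at the points below `t` plus those at the
points above `t` number at most `V(bottom partial sums at t) + V(top partial sums at t)`.  (For a hypothetical twenty of a
`(2,6)` pencil — 20 simple positive det-roots, midpoints `…CensusEnvelopeSetup.twenty_midpoints` — this is the row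
«`#roots < t` ≤ V(S(t))» ∧ «`#roots > t` ≤ V(T(t))», linear in the 21 coefficients at fixed `t`.) [this file] -/
theorem laguerre_rows (f : ℝ[X]) {N : ℕ} (hN : f.natDegree ≤ N) {t : ℝ} (ht : 0 < t)
    (xs ys : List ℝ) (hxs : xs.Pairwise (· < ·)) (hys : ys.Pairwise (· < ·))
    (hx0 : ∀ x ∈ xs, 0 < x) (hxt : ∀ x ∈ xs, x < t) (hyt : ∀ y ∈ ys, t < y) :
    sgnChanges (xs.map fun x => f.eval x) + sgnChanges (ys.map fun y => f.eval y)
      ≤ sgnChanges (slist (fun m => ∑ k ∈ Finset.range (m + 1), f.coeff k * t ^ k) N)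
        + sgnChanges (slist (fun m => ∑ k ∈ Finset.Ico m (N + 1), f.coeff k * t ^ k) N) :=
  Nat.add_le_add (laguerre_sgnChanges_below f hN ht xs hxs hx0 hxt) (laguerre_sgnChanges_above f hN ht ys hys hyt)

end Laguerre

end Summit.ValiantsHypothesis.ValiantsHypothesis.Theorems.LacunarySymmetroidMatrixDescartes.Census
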